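import Summits.QuantumFields.YangMills.Theses.CertificationLength
import Summits.QuantumFields.YangMills.Theorems.CertifiedHypercubicLimit.Negative.SiblingTie
import Summits.QuantumFields.YangMills.Theorems.PencilRigidityHypercubicLimitDefs
import Summits.QuantumFields.YangMills.Theorems.PencilRigidityHypercubicLimitDefsB
import Summits.QuantumFields.YangMills.Theorems.PencilRigidityHypercubicLimitCondMeanLocality
import Summits.QuantumFields.YangMills.Theorems.PencilRigidityHypercubicLimitTelescoping
import Summits.QuantumFields.YangMills.Theorems.PencilRigidityHypercubicLimitUniformBound
import Summits.QuantumFields.YangMills.Theorems.PencilRigidityHypercubicLimitSoftLegsU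
import Summits.QuantumFields.YangMills.Theorems.MirrorModularBoostsHypercubicLimitPeelReflectionLegs
import Summits.QuantumFields.YangMills.Theorems.HypercubicLimit.Negative.OneFieldReduction

/-!
# Line `certified-telescoping` for crux `CertifiedHypercubicLimit` (stmt-QuantumFields-16191) — strategist ALT line

Crux-strategist line (unit `cstrat-stmt-QuantumFields-16191-b1`, 2026-08-17), registered as an ALTERNATIVE to the
BC3 birth skeleton `Lines/birth.lean`.  Lens: TRANSFER at crux level — the sibling crux's BUILT line
`conditional-mean-telescoping` (cruxes stmt-8646 / 16154 / 16120, `Cruxes/HypercubicLimit/Lines/conditional_mean_telescoping.lean`,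
whose closure (U)+(S)+(R) is a tree theorem: `stub_uniformBound` p133385, `stub_softLegsU` p133612,
`reflectionLegsP_holds` p144898) ported to the CERTIFICATION SPACING, where this route's lever — the
Dobrushin–Shlosman certificate — SUPPLIES the sibling's imported infrared socket (L′) `LatticeGapInput`.

## The cut (6 stubs; the crux is concluded BY NAME by `CertifiedHypercubicLimit_of`)

In the sibling's currency `GapData G r β₁ C₁ c₂ m` = (i) `0 < m → 0`, (ii) all-pairs decay at rate `m(β)`, (iii)
RP-SPECTRAL relative clustering of slab functionals at rate `m(β)`, (iv) axial comparability of the plaquette RP square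
beyond `c₂/m(β)`, take the DS RATE `m(β) := κ(n,ε)/b(β)` with `b(β)` a CERTIFIED cell size at `β`:

* `stub_certifiedSpectralGap` (L; DS theory, the route's advertised mechanism (i)+(ii); group-blind, (A)-free,
  POINTWISE in `(β, b)`): admissible `(n, ε)` ⇒ `∃ κ > 0` such that a certificate at `(β, b)` gives (ii) all-pairs
  decay `C(A,B) e^{−κ t/b}` on EVERY torus (the PROVED engine `FiniteSizeCriterion` stmt-8895 on tori
  `2S+1 ≥ (8n+7)b`, boundedness below) and (iii) the RP-spectral relative clustering at rate `κ/b` with thermal error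
  `ε(S) → 0` (certificate ⇒ unique Gibbs state on the cylinder `(ℤ/(2S+1))³ × ℤ` ⇒ per-vector decay of
  `⟨Ŷ₀, Tᵗ Ŷ₀⟩` ⇒ spectral measure of `Ŷ₀` inside `[−e^{−κ/b}, e^{−κ/b}]` ⇒ relative bound with constant ONE;
  cylinder-vs-torus error by the DS strong-mixing sum `B²·#cells·(εM)^{⌊S/(2(2n+1)b)⌋}`).
* `stub_certifiedWindow` (L / open — THE BET of this line, "certification at the correlation scale", the
  refuter's structural finding 1 of RATTACK-16191 turned into a typed statement): under (A), for every compact simple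
  `G` and faithful `r` there is a CERTIFIED selection `b(β)` (`β ≥ β₁ ≥ 0`) and `C₁, c₂` with
  `e^{−C₁/b(β)} A(t) ≤ A(t+1)` for `t ≥ c₂ b(β)` (`A` = `rpSquare`, the plaquette RP square): the minimal
  certification length is `O(ξ_plaquette)`.  By log-convexity of `A` this is a two-point estimate at ONE height.
* `stub_certificationLengthDiverges` = the route's support item `CertificationLengthDiverges` (stmt-16181) BY NAME
  (M): certified sizes diverge as `β → ∞`, so `m → 0`, i.e. `a_k → 0` costs no `ξ(β) → ∞` theorem.
* `stub_influenceWindow : CornerFreeInfluence ∧ InfluenceReverseHolder`, `stub_windowRegularity : WindowRegularity`,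
  `stub_nonGaussianFloor : NonGaussianFloor` — VERBATIM the three ultraviolet sockets of the sibling registries
  (names and signatures identical to the registered stubs of `conditional_mean_telescoping.lean`; SHARED staffing:
  when they land there, these close by `exact`).

Composition (`CertifiedHypercubicLimit_of`, sorry-free): `GapData G r β₁ (C₁/κ) (c₂κ) (κ/b)` from the first three
stubs; (T)+(M) ⇒ Gaussian domination (landed `stub_telescoping`, `stub_condMeanLocality`, glue re-proved here);
`stub_uniformBound`, `stub_softLegsU`, `reflectionLegsP_holds` (all landed) give a scheme with `a_k = m(β_k) = κ/b(β_k)`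
— EXACTLY the crux's `a_k = ℓ₀/b_k` with `ℓ₀ := κ` — obeying any torus demand `Λ`, with `PolyRenorm` and the
one-field clauses; re-index (`shiftScheme`) so that `β_k ≥ β₁` and `k ≥ 2Q`, silence the other species
(`onlySpecies`, `extendByZero`, landed `clauses_of_clauses₁`), and read off the certificates, `a_k = κ/b_k`, the two
torus clauses (from `Λ`), weak coupling, one-field gauge and the package `W` with `Δ = 1`.

Disproof used: no `Cruxes/CertifiedHypercubicLimit/Disproof.lean` exists (payload path absent, 2026-08-17).  Landed
Negative for THIS crux: `SiblingTie` (imported; (A) ∧ (L) ⇒ 16120/16154) — consistent: this line IS the sibling line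
plus the certificate.  Sibling Disproof (HypercubicLimit): non-abelianness load-bearing — honoured at the UV sockets'
`IsCompactSimpleLieGroup G` and at `stub_certifiedWindow` (U(1)₄ has no certificate); `BetaMustLeaveZero` — `β_k → ∞`
from `SoftData`; `not_hasLatticeMassGapAllTimes` — every clustering clause keeps `t ≤ S` / `2(T+t+1) ≤ S`;
one-field witness legal (`hypercubicLimit_iff_oneField`).
-/

set_option autoImplicit false

noncomputable section

open scoped SchwartzMap ENNReal
open MeasureTheory Filter Topology
open Literature.MathematicalPhysics.AQFT Literature.MathematicalPhysics.QuantumLattice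
open Literature.MathematicalPhysics.QuantumFieldTheory
open Literature.Probability.LatticeModels (box Site)
open Summit.QuantumFields.YangMills.Theorems.HypercubicLimit.Negative
open Summit.QuantumFields.YangMills.Cruxes.HypercubicLimit.ConditionalMeanTelescoping

namespace Summit.QuantumFields.YangMills.Cruxes.CertifiedHypercubicLimit.CertifiedTelescoping

local notation "E4" => EuclideanSpace ℝ (Fin 4)

/-! ## §0 Vocabulary: the TV finite-size certificate (verbatim the crux's clause) and the shifted scheme -/

section Vocabulary

variable {G : Type} [Group G] [TopologicalSpace G] [IsTopologicalGroup G] [CompactSpace G] [MeasurableSpace G]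
  [BorelSpace G]

/-- **The Dobrushin–Shlosman TV finite-size certificate at `(β, b)` with parameters `(n, ε)`** — VERBATIM the
certificate clause of the crux `CertifiedHypercubicLimit` (and of `CompleteAnalyticityAtLargeScales`,
`CertificationLengthDiverges`, `FiniteSizeCriterion`): for every `[b,2b]`-frame `w`, every cell-union `Y` of the
`(4n+1)⁴`-cell cube containing the central cell, every two exteriors agreeing on the cube and every `[0,1]`-valued
measurable cylinder function `f` of the central cell, the two `γ_Y`-expectations of `f` differ by at most `ε`.
[cite: DobrushinShlosman1987, §2 (finite-size conditions)] -/
def Certified {N : ℕ} (ρ : G →* Matrix (Fin N) (Fin N) ℂ) (β : ℝ) (b n : ℕ) (ε : ℝ) : Prop :=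
  ∀ w : Fin 4 → ℤ → ℤ, (∀ i j, w i j + (b : ℤ) ≤ w i (j + 1) ∧ w i (j + 1) ≤ w i j + 2 * (b : ℤ)) →
    ∀ Y : Finset (Fin 4 → ℤ), Y ⊆ (Fintype.piFinset fun _ : Fin 4 => Finset.Icc (-(2 * (n : ℤ))) (2 * (n : ℤ))) →
    (0 : Fin 4 → ℤ) ∈ Y → ∀ η η' : LGConfig 4 G,
    (∀ e ∈ (Fintype.piFinset fun _ : Fin 4 => Finset.Icc (-(2 * (n : ℤ))) (2 * (n : ℤ))).biUnion
      (fun y : Fin 4 → ℤ => (Fintype.piFinset fun i : Fin 4 => Finset.Ico (w i (y i)) (w i (y i + 1))) ×ˢ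
        (Finset.univ : Finset (Fin 4))), η e = η' e) →
    ∀ f : LGConfig 4 G → ℝ, IsCylinder f ((fun y : Fin 4 → ℤ => (Fintype.piFinset fun i : Fin 4 =>
      Finset.Ico (w i (y i)) (w i (y i + 1))) ×ˢ (Finset.univ : Finset (Fin 4))) 0) → Measurable f →
    (∀ U, 0 ≤ f U ∧ f U ≤ 1) →
    |(∫ U, f U ∂(ymSpecification ρ β (Y.biUnion (fun y : Fin 4 → ℤ => (Fintype.piFinset
        fun i : Fin 4 => Finset.Ico (w i (y i)) (w i (y i + 1))) ×ˢ (Finset.univ : Finset (Fin 4)))) η)) -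
      ∫ U, f U ∂(ymSpecification ρ β (Y.biUnion (fun y : Fin 4 → ℤ => (Fintype.piFinset
        fun i : Fin 4 => Finset.Ico (w i (y i)) (w i (y i + 1))) ×ˢ (Finset.univ : Finset (Fin 4)))) η')| ≤ ε

end Vocabulary

/-- **Re-indexed scheme** `k ↦ k + k₀` (drops the first `k₀` lattices of a sequential scheme). [folklore] -/
def shiftScheme {ι : Type} (sch : SpeciesScheme ι) (k₀ : ℕ) : SpeciesScheme ι where
  a := fun k => sch.a (k + k₀)
  a_pos := fun _ => sch.a_pos _
  tendsto_a := sch.tendsto_a.comp (tendsto_add_atTop_nat k₀)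
  β := fun k => sch.β (k + k₀)
  L := fun k => sch.L (k + k₀)
  tendsto_L := sch.tendsto_L.comp (tendsto_add_atTop_nat k₀)
  c := fun s k => sch.c s (k + k₀)
  m := fun s k => sch.m s (k + k₀)

section Shift

variable {G : Type} [Group G] [TopologicalSpace G] [IsTopologicalGroup G] [CompactSpace G]
  [MeasurableSpace G] [BorelSpace G]

/-- The lattice `n`-point functions of the shifted scheme are the shifted lattice `n`-point functions. [folklore] -/
theorem latticeSchwinger_shift {N : ℕ} {ι : Type} (ρ : G →* Matrix (Fin N) (Fin N) ℂ) (sch : SpeciesScheme ι)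
    (obs : ι → LGConfig 4 G → ℝ) (k₀ k n : ℕ) (σ : Fin n → ι) (f : Fin n → 𝓢(E4, ℝ)) :
    latticeSchwinger ρ (shiftScheme sch k₀) obs k n σ f = latticeSchwinger ρ sch obs (k + k₀) n σ f := rfl

/-- The uniform lattice gap survives re-indexing. [folklore] -/
theorem hasLatticeMassGap_shift (r : LatticeRep G) {ι : Type} (sch : SpeciesScheme ι) (k₀ : ℕ) {Δ : ℝ}
    (h : HasLatticeMassGap r sch Δ) : HasLatticeMassGap r (shiftScheme sch k₀) Δ := by
  intro A B
  obtain ⟨C, hC⟩ := h A B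
  exact ⟨C, (tendsto_add_atTop_nat k₀).eventually hC⟩

end Shift

/-! ## §1 The registered stubs — the ONLY `sorry`s of the file -/

/-- **Stub 1 `stub_certifiedSpectralGap` — DS certificate ⇒ norm-uniform spectral gap at the DS rate (L; the
route's mechanism, provable-grade; group-blind and independent of (A)).**  For admissible `(n, ε)` there is `κ > 0`
such that for every compact `G`, `r`, and every `(β, b)` carrying the TV finite-size certificate:
(ii) for every pair of local gauge-invariant observables `|⟨A;τ_tB⟩_{β,2S+1}| ≤ C(A,B) e^{−κt/b}` for ALL `t ≤ S`
on EVERY torus (`C` independent of `β, b, S`: the proved `FiniteSizeCriterion` stmt-8895 for `2S+1 ≥ (8n+7)b`,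
`|⟨A;B⟩| ≤ 2‖A‖‖B‖ ≤ 2‖A‖‖B‖e^{κ(8n+7)/2}e^{−κt/b}` below); (iii) for `β ≥ 0` the RP-SPECTRAL relative
clustering of every bounded measurable slab functional `Y` (links with times in `[1,T]`, `2(T+t+1) ≤ S`):
`|⟨θY·τ_tY⟩ − ⟨Y⟩²| ≤ e^{−κt/b}(⟨θY·Y⟩ − ⟨Y⟩²) + ε(S)‖Y‖∞²` with `ε(S) → 0` (exactly clause (iii) of the sibling's
`GapData` at rate `κ/b`): certificate ⇒ DS uniqueness and strong mixing on the cylinder `(ℤ/(2S+1))³ × ℤ` ⇒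
per-vector exponential decay of `⟨Ŷ₀,TᵗŶ₀⟩` for the (self-adjoint, contractive) transfer operator of the RP cylinder
state ⇒ the spectral measure of `Ŷ₀` lives in `[−e^{−κ/b}, e^{−κ/b}]` ⇒ the relative bound with constant one
(`OSTransferSelfImprovement`); torus-vs-cylinder error `≤ B²·#cells·(εM(n))^{⌊S/(2(2n+1)b)⌋} =: ε(S)B²`. -/
theorem stub_certifiedSpectralGap :
    ∀ (n : ℕ) (ε : ℝ), 1 ≤ n → 0 ≤ ε → ε * (((4 * n + 3) ^ 4 - (4 * n + 1) ^ 4 : ℕ) : ℝ) < 1 →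
    ∃ κ : ℝ, 0 < κ ∧
    ∀ (G : Type) [Group G] [TopologicalSpace G] [IsTopologicalGroup G] [CompactSpace G] [MeasurableSpace G]
      [BorelSpace G] (r : LatticeRep G),
      (∀ A B : YMSpecies G, ∃ C : ℝ, ∀ (β : ℝ) (b : ℕ), 1 ≤ b → Certified r.ρ β b n ε →
        ∀ S t : ℕ, t ≤ S →
          |latticeConnectedCorr r.ρ β (2 * S + 1) A.F B.F t| ≤ C * Real.exp (-(κ / (b : ℝ) * t))) ∧
      (∀ (β : ℝ) (b : ℕ), 0 ≤ β → 1 ≤ b → Certified r.ρ β b n ε →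
        ∃ εS : ℕ → ℝ, Tendsto εS atTop (𝓝 0) ∧
        ∀ (S T t : ℕ), 2 * (T + t + 1) ≤ S →
          ∀ (Y : LGConfig 4 G → ℝ) (B : ℝ), Measurable Y → (∀ U, |Y U| ≤ B) →
            DependsOn Y {e : Literature.MathematicalPhysics.QuantumLattice.ZdEdge 4 |
                1 ≤ e.1 0 ∧ e.1 0 + (if e.2 = 0 then 1 else 0) ≤ T} →
              let μ := wilsonMeasure (d := 4) (L := 2 * S + 1) r.ρ β
              |(∫ U, Y (torusLift (2 * S + 1) (GaugeConfig.timeReflect U)) *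
                    Y (configShift (-Pi.single 0 (t : ℤ)) (torusLift (2 * S + 1) U)) ∂μ) -
                  (∫ U, Y (torusLift (2 * S + 1) U) ∂μ) ^ 2|
                ≤ Real.exp (-(κ / (b : ℝ) * t)) *
                    ((∫ U, Y (torusLift (2 * S + 1) (GaugeConfig.timeReflect U)) *
                        Y (torusLift (2 * S + 1) U) ∂μ) -
                      (∫ U, Y (torusLift (2 * S + 1) U) ∂μ) ^ 2) +
                  εS S * B ^ 2) := by
  sorry

/-- **Stub 2 `stub_certifiedWindow` — certification at the correlation scale (L / open; THE BET of the line).**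
Under (A): for every compact simple `G` and faithful `r` there are admissible `(n, ε)`, `β₁ ≥ 0`, a selection of
CERTIFIED cell sizes `b(β) ≥ 1` (`β ≥ β₁`) and constants `C₁, c₂` such that beyond height `c₂ b(β)` the plaquette RP
square `A(t) = rpSquare r β S t` decays between consecutive heights by at most the factor `e^{−C₁/b(β)}` on all large
tori (`4t+8 ≤ S`).  Since `t ↦ log A(t)` is convex (transfer matrix), the ratio `A(t+1)/A(t)` increases with `t`
towards `e^{−2m_P}`, so the statement says: the minimal certification length is at most a constant times the
plaquette correlation length `ξ_P(β)` (and is a TWO-POINT estimate at the single height `t₀ = ⌈c₂b⌉`: by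
log-convexity `A(t₀+1)/A(t₀) ≥ (A(t₀)/A(t₀/2))^{2/t₀}`).  This is where complete analyticity is asked AT the
correlation scale rather than at arbitrarily large scales — refuter finding 1 (RATTACK-16191: "(A) is UV-idle"). -/
theorem stub_certifiedWindow :
    Summit.QuantumFields.YangMills.Theses.CertificationLength.CompleteAnalyticityAtLargeScales →
    ∀ (G : Type) [Group G] [TopologicalSpace G] [IsTopologicalGroup G] [CompactSpace G] [MeasurableSpace G]
      [BorelSpace G], IsCompactSimpleLieGroup G → ∀ r : LatticeRep G,
      ∃ (n : ℕ) (ε β₁ C₁ c₂ : ℝ) (b : ℝ → ℕ),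
        1 ≤ n ∧ 0 ≤ ε ∧ ε * (((4 * n + 3) ^ 4 - (4 * n + 1) ^ 4 : ℕ) : ℝ) < 1 ∧ 0 ≤ β₁ ∧
        (∀ β : ℝ, β₁ ≤ β → 1 ≤ b β ∧ Certified r.ρ β (b β) n ε) ∧
        (∀ β : ℝ, β₁ ≤ β → ∃ S₀ : ℕ, ∀ S : ℕ, S₀ ≤ S → ∀ t : ℕ, c₂ * (b β : ℝ) ≤ t → 4 * t + 8 ≤ S →
          Real.exp (-(C₁ / (b β : ℝ))) * rpSquare r β S t ≤ rpSquare r β S (t + 1)) := by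
  sorry

/-- **Stub 3 `stub_certificationLengthDiverges` — BY NAME the route's support item `CertificationLengthDiverges`
(stmt-QuantumFields-16181; M).**  For every compact `G`, faithful `r` and admissible `(n, ε)`: for every `B` there is
`β₂` such that for `β ≥ β₂` NO cell size `1 ≤ b ≤ B` is certified (Laplace concentration on exterior-steered
minimisers).  Consequence used here: certified selections `b(β)` diverge, so the DS rate `κ/b(β) → 0`. -/
theorem stub_certificationLengthDiverges :
    Summit.QuantumFields.YangMills.Theses.CertificationLength.CertificationLengthDiverges := by
  sorry

/-- **Stub 4 `stub_influenceWindow` = (WI₂) ∧ (WIₙ)** — VERBATIM the sibling registries' INFLUENCE WINDOW socket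
(`conditional_mean_telescoping.lean`, cruxes stmt-8646 / 16154 / 16120; shared staffing). -/
theorem stub_influenceWindow : CornerFreeInfluence ∧ InfluenceReverseHolder := by
  sorry

/-- **Stub 5 `stub_windowRegularity` = (W2)** — VERBATIM the sibling registries' window-regularity socket. -/
theorem stub_windowRegularity : WindowRegularity := by
  sorry

/-- **Stub 6 `stub_nonGaussianFloor` = (NG)** — VERBATIM the sibling registries' scale-free `κ₃` floor socket. -/
theorem stub_nonGaussianFloor : NonGaussianFloor := by
  sorry

/-! ## §2 Glue (sorry-free): (T)+(M) ⇒ Gaussian domination, re-proved here from the LANDED stubs -/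

/-- (T) Wilson-torus telescoping bound (verbatim the sibling skeleton's `TelescopingBound`). [folklore] -/
def TelescopingBound : Prop :=
  ∀ (G : Type) [Group G] [TopologicalSpace G] [IsTopologicalGroup G] [CompactSpace G]
    [MeasurableSpace G] [BorelSpace G] (r : LatticeRep G) (β : ℝ) (S R n : ℕ)
    (o : Fin n → Fin 4 × Fin 4) (x : Fin n → Site 4),
    (∀ k, (o k).1 ≠ (o k).2) →
    4 * R + 4 < 2 * S + 1 →
    (∀ k l, k ≠ l → ∃ μ : Fin 4, (2 * R + 1 : ℤ) < |x k μ - x l μ| ∧ |x k μ - x l μ| ≤ S) →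
      let μ := wilsonMeasure (d := 4) (L := 2 * S + 1) r.ρ β
      |∫ U, ∏ k, (torusPlaquette r (2 * S + 1) (o k).1 (o k).2 (x k) U -
          ∫ V, torusPlaquette r (2 * S + 1) (o k).1 (o k).2 (x k) V ∂μ) ∂μ|
        ≤ ∏ k, influence r β S R (x k) (o k).1 (o k).2 n

/-- (M) Exact antitonicity of the influence profile (verbatim the sibling skeleton's `InfluenceAntitone`). [folklore] -/
def InfluenceAntitone : Prop :=
  ∀ (G : Type) [Group G] [TopologicalSpace G] [IsTopologicalGroup G] [CompactSpace G]
    [MeasurableSpace G] [BorelSpace G] (r : LatticeRep G) (β : ℝ) (S : ℕ) (x : Site 4) (i j : Fin 4)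
    (p : ℝ≥0∞), 1 ≤ p → ∀ R R' : ℕ, R' ≤ R → 2 * R + 2 < 2 * S + 1 →
      influence r β S R x i j p ≤ influence r β S R' x i j p

/-- (T) ∧ (M) are the LANDED tree theorems `stub_telescoping` (p74162) ∘ `stub_condMeanLocality` (p76246). -/
theorem telescoping_holds : TelescopingBound ∧ InfluenceAntitone :=
  stub_telescoping stub_condMeanLocality

/-- The influence profile is non-negative. -/
theorem influence_nonneg' {G : Type} [Group G] [TopologicalSpace G] [IsTopologicalGroup G]
    [CompactSpace G] [MeasurableSpace G] [BorelSpace G] (r : LatticeRep G) (β : ℝ) (S R : ℕ)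
    (x : Site 4) (i j : Fin 4) (p : ℝ≥0∞) : 0 ≤ influence r β S R x i j p :=
  ENNReal.toReal_nonneg

/-- **(T) ∧ (M), (WI₂), (WIₙ) ⇒ Gaussian domination** (the sibling skeleton's glue, re-proved verbatim). -/
theorem gaussianDomination_of (hT : TelescopingBound ∧ InfluenceAntitone)
    (h₂ : CornerFreeInfluence) (hₙ : InfluenceReverseHolder) : GaussianDomination := by
  intro G _ _ _ _ _ _ hG r β₁ C₁ c₂ m hgap c₀ hc₀
  obtain ⟨C₂, β₂, h₂'⟩ := h₂ G hG r β₁ C₁ c₂ m hgap c₀ hc₀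
  obtain ⟨Cₙ, βₙ, γ, hₙ'⟩ := hₙ G hG r β₁ C₁ c₂ m hgap c₀ hc₀
  refine ⟨max Cₙ 0 * max C₂ 0, max β₂ βₙ, γ, fun β hβ n hn => ?_⟩
  obtain ⟨S₂, hS₂⟩ := h₂' β (le_trans (le_max_left _ _) hβ)
  obtain ⟨Sₙ, hSₙ⟩ := hₙ' β (le_trans (le_max_right _ _) hβ) n hn
  refine ⟨max S₂ Sₙ, fun S hS R R' o x ho hR' hR'R hR'c hfit hsep => ?_⟩
  have hS₂' : S₂ ≤ S := le_trans (le_max_left _ _) hS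
  have hSₙ' : Sₙ ≤ S := le_trans (le_max_right _ _) hS
  have step1 := hT.1 G r β S R n o x ho hfit hsep
  have hp : (1 : ℝ≥0∞) ≤ (n : ℝ≥0∞) := by exact_mod_cast (le_trans (by norm_num) hn : 1 ≤ n)
  have hfitR : 2 * R + 2 < 2 * S + 1 := by omega
  have hfactor : ∀ k : Fin n,
      influence r β S R (x k) (o k).1 (o k).2 n ≤
        max Cₙ 0 * max C₂ 0 * (n : ℝ) ^ γ * Real.sqrt (rpSquare r β S R') := by
    intro k
    have hij : (o k).1 ≠ (o k).2 := ho k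
    have a1 : influence r β S R (x k) (o k).1 (o k).2 n ≤
        influence r β S R' (x k) (o k).1 (o k).2 n :=
      hT.2 G r β S (x k) (o k).1 (o k).2 n hp R R' hR'R hfitR
    have a2 : influence r β S R' (x k) (o k).1 (o k).2 n ≤
        Cₙ * (n : ℝ) ^ γ * influence r β S R' (x k) (o k).1 (o k).2 2 :=
      hSₙ S hSₙ' R' hR' hR'c (x k) (o k).1 (o k).2 hij
    have a3 : influence r β S R' (x k) (o k).1 (o k).2 2 ≤ C₂ * Real.sqrt (rpSquare r β S R') :=
      hS₂ S hS₂' R' hR' hR'c (x k) (o k).1 (o k).2 hij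
    have hI2 : 0 ≤ influence r β S R' (x k) (o k).1 (o k).2 2 := influence_nonneg' _ _ _ _ _ _ _ _
    have hsq : 0 ≤ Real.sqrt (rpSquare r β S R') := Real.sqrt_nonneg _
    have hnγ : 0 ≤ (n : ℝ) ^ γ := by positivity
    have a2' : influence r β S R' (x k) (o k).1 (o k).2 n ≤
        max Cₙ 0 * (n : ℝ) ^ γ * influence r β S R' (x k) (o k).1 (o k).2 2 := by
      refine le_trans a2 ?_
      have : Cₙ * (n : ℝ) ^ γ ≤ max Cₙ 0 * (n : ℝ) ^ γ :=
        mul_le_mul_of_nonneg_right (le_max_left _ _) hnγ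
      exact mul_le_mul_of_nonneg_right this hI2
    have a3' : influence r β S R' (x k) (o k).1 (o k).2 2 ≤
        max C₂ 0 * Real.sqrt (rpSquare r β S R') := by
      refine le_trans a3 ?_
      exact mul_le_mul_of_nonneg_right (le_max_left _ _) hsq
    have hC : 0 ≤ max Cₙ 0 * (n : ℝ) ^ γ := mul_nonneg (le_max_right _ _) hnγ
    calc influence r β S R (x k) (o k).1 (o k).2 n
        ≤ influence r β S R' (x k) (o k).1 (o k).2 n := a1
      _ ≤ max Cₙ 0 * (n : ℝ) ^ γ * influence r β S R' (x k) (o k).1 (o k).2 2 := a2'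
      _ ≤ max Cₙ 0 * (n : ℝ) ^ γ * (max C₂ 0 * Real.sqrt (rpSquare r β S R')) :=
          mul_le_mul_of_nonneg_left a3' hC
      _ = max Cₙ 0 * max C₂ 0 * (n : ℝ) ^ γ * Real.sqrt (rpSquare r β S R') := by ring
  have step2 : ∏ k : Fin n, influence r β S R (x k) (o k).1 (o k).2 n ≤
      ∏ _k : Fin n, (max Cₙ 0 * max C₂ 0 * (n : ℝ) ^ γ * Real.sqrt (rpSquare r β S R')) :=
    Finset.prod_le_prod (fun k _ => influence_nonneg' _ _ _ _ _ _ _ _) (fun k _ => hfactor k)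
  rw [Finset.prod_const, Finset.card_univ, Fintype.card_fin] at step2
  exact le_trans step1 step2

/-- Gaussian domination holds modulo the influence-window socket. -/
theorem gaussianDomination_holds : GaussianDomination :=
  gaussianDomination_of telescoping_holds stub_influenceWindow.1 stub_influenceWindow.2

/-- `SoftData` is antitone in the torus demand. [folklore] -/
theorem softData_anti {G : Type} [Group G] [TopologicalSpace G] [IsTopologicalGroup G] [CompactSpace G]
    [MeasurableSpace G] [BorelSpace G] {r : LatticeRep G} {m : ℝ → ℝ} {δ₀ : ℝ} {Λ Λ' : ℝ → ℕ → ℕ}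
    {sch : SpeciesScheme (YMSpecies G)} {S₁ : SchwingerFamily E4}
    {Spl : (n : ℕ) → (Fin n → Fin 4 × Fin 4) → (𝓢((Fin n → E4), ℂ) →L[ℂ] ℂ)}
    (h : SoftData r m δ₀ Λ sch S₁ Spl) (hle : ∀ β k, Λ' β k ≤ Λ β k) : SoftData r m δ₀ Λ' sch S₁ Spl := by
  obtain ⟨h1, h2, h3, hrest⟩ := h
  exact ⟨h1, h2, fun k => (hle _ _).trans (h3 k), hrest⟩

/-! ## §3 Arithmetic glue for the torus clauses -/

/-- The `log²` torus clause from the polynomial renormalisation bound: if `0 ≤ c ≤ u^Q`, `0 < u`, `2Q ≤ j` and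
`⌈u^(j+1)⌉₊ + 1 ≤ L`, then `log (|c| + 1)² ≤ u⁻¹ L`. [folklore] -/
theorem log_sq_le_of_polyRenorm {c u L : ℝ} {Q j : ℕ} (hc : 0 ≤ c) (hu : 0 < u) (hcQ : c ≤ u ^ Q)
    (hQj : 2 * Q ≤ j) (hL : (⌈u ^ (j + 1)⌉₊ : ℝ) + 1 ≤ L) :
    Real.log (|c| + 1) ^ 2 ≤ u⁻¹ * L := by
  rw [abs_of_nonneg hc]
  have h1 : 0 < c + 1 := by linarith
  have hlog_le : Real.log (c + 1) ≤ c := by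
    have := Real.log_le_sub_one_of_pos h1
    linarith
  have hlog_nn : 0 ≤ Real.log (c + 1) := Real.log_nonneg (by linarith)
  have h2 : Real.log (c + 1) ^ 2 ≤ c ^ 2 := pow_le_pow_left₀ hlog_nn hlog_le 2
  have h3 : c ^ 2 ≤ (u ^ Q) ^ 2 := pow_le_pow_left₀ hc hcQ 2
  have h4 : (u ^ Q) ^ 2 = u ^ (2 * Q) := by rw [← pow_mul, mul_comm]
  -- `u^(2Q+1) ≤ L`
  have h5 : u ^ (2 * Q + 1) ≤ L := by
    rcases le_or_gt 1 u with hu1 | hu1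
    · have : u ^ (2 * Q + 1) ≤ u ^ (j + 1) := pow_le_pow_right₀ hu1 (by omega)
      have hceil : u ^ (j + 1) ≤ (⌈u ^ (j + 1)⌉₊ : ℝ) := Nat.le_ceil _
      linarith
    · have : u ^ (2 * Q + 1) ≤ 1 := pow_le_one₀ hu.le hu1.le
      have hceil : (0 : ℝ) ≤ (⌈u ^ (j + 1)⌉₊ : ℝ) := Nat.cast_nonneg _
      linarith
  have h6 : u ^ (2 * Q) ≤ u⁻¹ * L := by
    rw [le_inv_mul_iff₀ hu]
    calc u * u ^ (2 * Q) = u ^ (2 * Q + 1) := by ring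
      _ ≤ L := h5
  calc Real.log (c + 1) ^ 2 ≤ c ^ 2 := h2
    _ ≤ (u ^ Q) ^ 2 := h3
    _ = u ^ (2 * Q) := h4
    _ ≤ u⁻¹ * L := h6

/-! ## §4 Assembly — sorry-free; concludes the route decl BY NAME -/

set_option maxHeartbeats 1600000 in
/-- **Composition**: the six stubs give the crux `CertifiedHypercubicLimit` BY NAME.  Stub 2 gives admissible `(n, ε)`,
the certified selection `b(β)` and axial comparability; Stub 3 makes `b(β) → ∞`; Stub 1 gives `κ` and clauses
(ii), (iii) — together `GapData G r β₁ (C₁/κ) (c₂κ) (κ/b)`; the landed closure of the sibling line fed by Stubs 4–6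
gives a scheme in units `a = κ/b(β)` for an arbitrary torus demand, with `PolyRenorm` and all one-field clauses;
shift, silence the other species, and read off the crux with `ℓ₀ := κ`, `bseq k := b(β_{k+k⋆})`, `Δ := 1`. -/
theorem CertifiedHypercubicLimit_of :
    Summit.QuantumFields.YangMills.Theses.CertificationLength.CertifiedHypercubicLimit := by
  intro hA G _ _ _ _ hG
  letI : MeasurableSpace G := borel G
  haveI : BorelSpace G := ⟨rfl⟩
  show ∀ r : LatticeRep G, _
  intro r
  classical
  -- Stub 2: admissible (n, ε), certified selection b(β), axial comparability
  obtain ⟨n, ε, β₁, C₁, c₂, b, hn, hε, hM, hβ₁, hcert, hwin⟩ := stub_certifiedWindow hA G hG r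
  -- Stub 3: certified sizes diverge
  have hdiv := stub_certificationLengthDiverges G r n ε hn hε hM
  have hb_ge : ∀ B : ℕ, ∃ β₀ : ℝ, ∀ β, β₀ ≤ β → B < b β := by
    intro B
    obtain ⟨β₂, hβ₂⟩ := hdiv B
    refine ⟨max β₁ β₂, fun β hβ => ?_⟩
    by_contra hle
    push Not at hle
    exact hβ₂ β (le_trans (le_max_right _ _) hβ) (b β) (hcert β (le_trans (le_max_left _ _) hβ)).1 hle
      (hcert β (le_trans (le_max_left _ _) hβ)).2
  have hb_tendsto : Tendsto (fun β => (b β : ℝ)) atTop atTop := by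
    refine tendsto_atTop_atTop.2 fun C => ?_
    obtain ⟨β₀, hβ₀⟩ := hb_ge ⌈C⌉₊
    refine ⟨β₀, fun β hβ => ?_⟩
    have h1 : (⌈C⌉₊ : ℝ) < (b β : ℝ) := by exact_mod_cast hβ₀ β hβ
    exact le_trans (Nat.le_ceil C) h1.le
  -- Stub 1: the DS rate κ and clauses (ii), (iii)
  obtain ⟨κ, hκ, hcore⟩ := stub_certifiedSpectralGap n ε hn hε hM
  obtain ⟨hii, hiii⟩ := hcore G r
  -- the rate function of the sibling's GapData
  set m : ℝ → ℝ := fun β => κ / (b β : ℝ) with hm_def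
  have hbpos : ∀ β, β₁ ≤ β → (0 : ℝ) < (b β : ℝ) := fun β hβ => by
    have := (hcert β hβ).1
    exact_mod_cast (lt_of_lt_of_le zero_lt_one this)
  have hgap : GapData G r β₁ (C₁ / κ) (c₂ * κ) m := by
    refine ⟨fun β hβ => div_pos hκ (hbpos β hβ), tendsto_const_nhds.div_atTop hb_tendsto, ?_, ?_, ?_⟩
    · -- (ii) all-pairs decay
      intro A B
      obtain ⟨C, hC⟩ := hii A B
      exact ⟨C, 0, fun β hβ S _ t ht => hC β (b β) (hcert β hβ).1 (hcert β hβ).2 S t ht⟩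
    · -- (iii) RP-spectral relative clustering
      intro β hβ
      exact hiii β (b β) (hβ₁.trans hβ) (hcert β hβ).1 (hcert β hβ).2
    · -- (iv) axial comparability, constants rescaled by κ
      intro β hβ
      obtain ⟨S₀, hS₀⟩ := hwin β hβ
      refine ⟨S₀, fun S hS t ht hfit => ?_⟩
      have hb0 : (b β : ℝ) ≠ 0 := (hbpos β hβ).ne'
      have hκ0 : κ ≠ 0 := hκ.ne'
      have e1 : c₂ * κ / m β = c₂ * (b β : ℝ) := by
        simp only [hm_def]; field_simp
      have e2 : C₁ / κ * m β = C₁ / (b β : ℝ) := by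
        simp only [hm_def]; field_simp
      rw [e2]
      rw [e1] at ht
      exact hS₀ S hS t ht hfit
  -- the sibling closure, fed by Stubs 4–6 (all other pieces landed)
  have hU : UniformBound := stub_uniformBound gaussianDomination_holds stub_windowRegularity
  have hSoft := stub_softLegsU hU stub_windowRegularity stub_nonGaussianFloor G hG r β₁ (C₁ / κ) (c₂ * κ) m hgap
  obtain ⟨ΛR, hΛR⟩ :=
    Summit.QuantumFields.YangMills.Cruxes.HypercubicLimit.PeelAndDisseminate.reflectionLegsP_holds
      G hG r β₁ (C₁ / κ) (c₂ * κ) m hgap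
  -- our torus demand: the reflection legs' demand, (8n+7) b(β), and the log² budget ⌈(b/κ)^(k+1)⌉ + 1
  set N : ℝ → ℕ → ℕ := fun β k => (8 * n + 7) * b β + (⌈((b β : ℝ) / κ) ^ (k + 1)⌉₊ + 1) with hN_def
  set Λ : ℝ → ℕ → ℕ := fun β k => max (ΛR β k) (N β k) with hΛ_def
  obtain ⟨δ₀, sch, S₁, Spl, hδ₀, hD, ⟨Q, hQ⟩, hSC⟩ := hSoft Λ
  have hRefl : ReflClauses S₁ :=
    hΛR δ₀ sch S₁ Spl hδ₀ (softData_anti hD fun β k => le_max_left _ _) ⟨Q, hQ⟩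
  obtain ⟨ha, hβlim, hΛL, hNpos, hc, -⟩ := hD
  obtain ⟨hE0, hE0', hE3, htr, hconv, hNT, hNG, hlat⟩ := hSC
  obtain ⟨hherm, hRP, hcl, hhyp, hgap1⟩ := hRefl
  -- re-index: β_k ≥ β₁ and k ≥ 2Q beyond k⋆
  obtain ⟨k₀, hk₀⟩ := eventually_atTop.1 (hβlim.eventually_ge_atTop β₁)
  set kS : ℕ := max k₀ (2 * Q) with hkS_def
  have hkβ : ∀ k, β₁ ≤ sch.β (k + kS) := fun k => hk₀ _ (le_trans (le_max_left _ _) (Nat.le_add_left _ _))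
  have hkQ : ∀ k, 2 * Q ≤ k + kS := fun k => le_trans (le_max_right _ _) (Nat.le_add_left _ _)
  -- the witness
  refine ⟨n, ε, κ, fun k => b (sch.β (k + kS)), onlySpecies (shiftScheme sch kS) r.curvature,
    extendByZero r.curvature S₁, hn, hε, hM, hκ, ?_, ?_, ?_, ?_, ?_, ?_⟩
  · -- certificates at (β_k, b_k)
    intro k
    exact ⟨hβ₁.trans (hkβ k), (hcert _ (hkβ k)).1, (hcert _ (hkβ k)).2⟩
  · -- a_k = κ / b_k
    intro k
    exact ha (k + kS)
  · -- torus clauses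
    intro k
    have hL : Λ (sch.β (k + kS)) (k + kS) ≤ sch.L (k + kS) := hΛL (k + kS)
    have hNL : N (sch.β (k + kS)) (k + kS) ≤ sch.L (k + kS) := le_trans (le_max_right _ _) hL
    have hNL' : (8 * n + 7) * b (sch.β (k + kS)) +
        (⌈((b (sch.β (k + kS)) : ℝ) / κ) ^ (k + kS + 1)⌉₊ + 1) ≤ sch.L (k + kS) := hNL
    refine ⟨?_, ?_⟩
    · show (8 * n + 7) * b (sch.β (k + kS)) ≤ 2 * sch.L (k + kS) + 1
      omega
    · have hcurv : (onlySpecies (shiftScheme sch kS) r.curvature).c r.curvature k = sch.c r.curvature (k + kS) := by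
        simp [onlySpecies, shiftScheme]
      rw [hcurv]
      show Real.log (|sch.c r.curvature (k + kS)| + 1) ^ 2 ≤ sch.a (k + kS) * (sch.L (k + kS) : ℝ)
      have hβk := hkβ k
      have hbk : (0 : ℝ) < (b (sch.β (k + kS)) : ℝ) := hbpos _ hβk
      set u : ℝ := (b (sch.β (k + kS)) : ℝ) / κ with hu_def
      have hu : 0 < u := div_pos hbk hκ
      have hau : sch.a (k + kS) = u⁻¹ := by
        rw [ha (k + kS), hu_def, inv_div]
      have hcpos : 0 < sch.c r.curvature (k + kS) := by
        rw [hc (k + kS)]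
        exact inv_pos.2 (Real.sqrt_pos.2 (hNpos (k + kS)))
      have hcQ : sch.c r.curvature (k + kS) ≤ u ^ Q := by
        have := hQ (k + kS)
        rwa [hau, inv_inv] at this
      have hLreal : (⌈u ^ (k + kS + 1)⌉₊ : ℝ) + 1 ≤ (sch.L (k + kS) : ℝ) := by
        have h' : ⌈u ^ (k + kS + 1)⌉₊ + 1 ≤ sch.L (k + kS) := by
          have := hNL'
          omega
        exact_mod_cast h'
      rw [hau]
      exact log_sq_le_of_polyRenorm hcpos.le hu hcQ (hkQ k) hLreal
  · -- weak coupling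
    show Tendsto (fun k => sch.β (k + kS)) atTop atTop
    exact hβlim.comp (tendsto_add_atTop_nat kS)
  · -- one-field gauge
    rintro n' k' ⟨i, hi⟩ F
    rw [extendByZero_of_not_all _ _ (fun h => hi (h i))]
    rfl
  · -- the package W: one-field witness along the shifted scheme, then silence the other species
    refine clauses_of_clauses₁ ⟨⟨hE0, hherm, hE0', hRP, hE3, hcl, htr, hhyp⟩, ?_, hNT, hNG, 1, one_pos, hgap1,
      hasLatticeMassGap_shift r sch kS hlat⟩
    intro n' hn' f F hF hod
    simp_rw [latticeSchwinger_shift]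
    exact (hconv n' hn' f F hF hod).comp (tendsto_add_atTop_nat kS)

end Summit.QuantumFields.YangMills.Cruxes.CertifiedHypercubicLimit.CertifiedTelescoping

end
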